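import Summits.BirchSwinnertonDyer.Rank1Residual.X11b.CoinducedShift
import Literature.NumberTheory.GaloisRepresentations.ContinuousCohomologyConnecting
import Literature.NumberTheory.GaloisRepresentations.LocalOneUnitsProofs
import HarnessLib

/-!
# X11b, route R1 — `0 → A → M_G^H(A) →(S_γ − 1) M_G^H(A) → 0` is SHORT EXACT for `H = ker(κ :
# G ↠ ℤ_p)`, `κ(γ) = 1`, `A` a `p`-primary discrete `G`-module

HONEST FRAMING (cell `b2b-bsdres`, run/shared/lean/b2b/bsd-rank1-residual/, verbatim in every
file): the goal of the cell is to DELETE the COMBINATION-SHAPED residual classes of the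
Birch–Swinnerton-Dyer formula for ALL analytic-rank `≤ 1` elliptic curves over `ℚ` — "full BSD
formula for every rank `≤ 1` curve in class `C`" assembled STRICTLY from published theorems — so
that the rank-`≤ 1` remainder becomes exactly the CONSTRUCTION-SHAPED classes, which are TYPED
(missing-input `Prop`s), NOT attempted. This is not "finishing BSD". Sub-cell
`b2b-bsdres-multr1-p1` (X11b, route R1 = Castella 2018 Thm. A re-proved along the author's
erratum); a RESEARCH ROUTE; no claim beyond the stated class; X11b stays CONSTRUCTION-SHAPED;
nothing here changes a label; no named fact is minted (definitions with bodies and theorems; no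
`sorry`).

## What this file does

Continues `CoinducedShift.lean` (JSW17 Lemma 3.3.3's `0 → W → M →(γ − 1) M → 0` on the tree's
Serre model `M_G^H(A)`). For a topological group `G`, a continuous homomorphism
`κ : G →ₜ* ℤ_p` (surjective where needed; e.g. a `ℤ_p`-extension `κ : Γ_K ↠ ℤ_p` of the tree),
`H = ker κ`, `γ` with `κ(γ) = 1`, and a discrete `G`-module `A`:

* `toZp κ`, `descend` — `κ` read additively and the DESCENT of an `H`-invariant continuous
  function `G → B` to a continuous function `ℤ_p → B` (`G → ℤ_p` is a quotient map for compact
  `G`); `exists_factor_toZModPow` — a continuous function `ℤ_p → B` into a discrete space factors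
  through some `ℤ/p^m` (compactness); `sum_range_mul_eq_smul_sum` (periodic sums);
* `exists_unit_eq_of_tHom_eq_zero` — **exactness in the middle**: `S_γ a = a ⟹ a = unit(a(1))`
  (a continuous function on `G/H ≅ ℤ_p` invariant under `t ↦ t + 1` is constant: density of `ℤ`);
* `tHom_surjective` — **`S_γ − 1` is onto when `A` is `p`-PRIMARY**: the telescoping primitive
  `Ψ(t) = Σ_{i < t mod p^N} ψ(i)` of the descended locally constant `ψ = (x ↦ x⁻¹ • b(x))` is well
  defined on `ℤ/p^N` because `Σ_{i<p^N} ψ(i) = p^{N−m} • Σ_{i<p^m} ψ(i) = 0` for `N = m + e + 1`,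
  `p^e` killing the period sum; `a(x) = x • Ψ(κ x)` solves `(S_γ − 1) a = b`;
* **`isSES_unit_tHom`**: `IsSES (unitHom) (tHom γ)` — the input of the tree's long exact sequence
  (`ContinuousCohomologyConnecting`) used by `ProcyclicDescent.lean`.

References: [JetchevSkinnerWan2017] Lemma 3.3.3 (arXiv:1512.06894 p. 11);
[SerreGaloisCohomology1997] I §2.5; [Castella2018] Thm. 2.3 (arXiv:1704.06608 p. 5).
-/

noncomputable section

open CategoryTheory Function
open Literature.NumberTheory.GaloisRepresentations Literature.NumberTheory.EllipticCurves

universe u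

namespace Summit.BirchSwinnertonDyer.Rank1Residual.X11b.ProcyclicDescent

/-! ## 3. `ℤ_p`-quotients: `κ : G ↠ ℤ_p`, descent of `H`-invariant functions, locally constant
functions on `ℤ_p` -/

section ZpQuotient

variable {G : Type u} [Group G] [TopologicalSpace G]
variable {p : ℕ} [Fact p.Prime] (κ : G →ₜ* Multiplicative ℤ_[p])

/-- `κ` read additively: `G → ℤ_p`. [folklore] -/
def toZp (g : G) : ℤ_[p] := (κ g).toAdd

/-- Unfolding `toZp`. [folklore] -/
theorem toZp_apply (g : G) : toZp κ g = (κ g).toAdd := rfl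

/-- `toZp κ` is continuous. [folklore] -/
theorem continuous_toZp : Continuous (toZp κ) := continuous_toAdd.comp κ.continuous

omit [TopologicalSpace G] in
/-- `toZp κ (g g') = toZp κ g + toZp κ g'`. [folklore] -/
@[simp] theorem toZp_mul (κ : G →* Multiplicative ℤ_[p]) (g g' : G) :
    (κ (g * g')).toAdd = (κ g).toAdd + (κ g').toAdd := by
  rw [map_mul, toAdd_mul]

/-- `toZp κ (g g') = toZp κ g + toZp κ g'`. [folklore] -/
@[simp] theorem toZp_mul' (g g' : G) : toZp κ (g * g') = toZp κ g + toZp κ g' := by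
  rw [toZp_apply, toZp_apply, toZp_apply, map_mul, toAdd_mul]

/-- `toZp κ h = 0` for `h ∈ ker κ`. [folklore] -/
theorem toZp_eq_zero_of_mem {h : G} (hh : h ∈ (κ : G →* Multiplicative ℤ_[p]).ker) :
    toZp κ h = 0 := by
  rw [MonoidHom.mem_ker] at hh
  rw [toZp_apply]
  exact congrArg Multiplicative.toAdd hh

/-- `toZp κ x = toZp κ y` iff `y x⁻¹ ∈ ker κ`. [folklore] -/
theorem toZp_eq_toZp_iff (x y : G) :
    toZp κ x = toZp κ y ↔ y * x⁻¹ ∈ (κ : G →* Multiplicative ℤ_[p]).ker := by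
  rw [MonoidHom.mem_ker, map_mul, map_inv, mul_inv_eq_one, eq_comm, toZp_apply, toZp_apply]
  exact ⟨fun h => Multiplicative.toAdd.injective h, fun h => congrArg _ h⟩

/-- `toZp κ` is onto when `κ` is. [folklore] -/
theorem toZp_surjective (hκ : Surjective κ) : Surjective (toZp κ) := fun t => by
  obtain ⟨g, hg⟩ := hκ (Multiplicative.ofAdd t)
  exact ⟨g, by rw [toZp_apply]; exact congrArg Multiplicative.toAdd hg⟩

/-- **`G → ℤ_p` is a quotient map** for `G` compact (closed continuous surjection). [folklore] -/
theorem isQuotientMap_toZp [CompactSpace G] (hκ : Surjective κ) :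
    Topology.IsQuotientMap (toZp κ) :=
  (continuous_toZp κ).isClosedMap.isQuotientMap (continuous_toZp κ) (toZp_surjective κ hκ)

variable {B : Type*}

/-- **Descent along `κ`** of a function `φ : G → B` constant on the cosets of `ker κ`: the function
`ℤ_p → B` with `descend φ (toZp κ x) = φ x`. [folklore] -/
def descend (hκ : Surjective κ) (φ : G → B) : ℤ_[p] → B :=
  φ ∘ surjInv (toZp_surjective κ hκ)

/-- `descend φ (κ x) = φ x` for `φ` invariant under left multiplication by `ker κ`. [folklore] -/
theorem descend_toZp (hκ : Surjective κ) {φ : G → B}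
    (hφ : ∀ h ∈ (κ : G →* Multiplicative ℤ_[p]).ker, ∀ x, φ (h * x) = φ x) (x : G) :
    descend κ hκ φ (toZp κ x) = φ x := by
  have hs : toZp κ (surjInv (toZp_surjective κ hκ) (toZp κ x)) = toZp κ x :=
    surjInv_eq (toZp_surjective κ hκ) _
  rw [toZp_eq_toZp_iff] at hs
  have e : x = (x * (surjInv (toZp_surjective κ hκ) (toZp κ x))⁻¹) *
      surjInv (toZp_surjective κ hκ) (toZp κ x) := by group
  rw [descend, Function.comp_apply]
  conv_rhs => rw [e, hφ _ hs]

/-- The descent of a CONTINUOUS invariant function is continuous (`toZp` is a quotient map).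
[folklore] -/
theorem continuous_descend [CompactSpace G] [TopologicalSpace B] (hκ : Surjective κ)
    {φ : G → B} (hφc : Continuous φ)
    (hφ : ∀ h ∈ (κ : G →* Multiplicative ℤ_[p]).ker, ∀ x, φ (h * x) = φ x) :
    Continuous (descend κ hκ φ) := by
  rw [(isQuotientMap_toZp κ hκ).continuous_iff]
  have e : descend κ hκ φ ∘ toZp κ = φ := funext fun x => descend_toZp κ hκ hφ x
  rwa [e]

/-- **A continuous function from `ℤ_p` to a discrete space factors through some `ℤ/p^m`**
(compactness of `ℤ_p`). [folklore] -/
theorem exists_factor_toZModPow [TopologicalSpace B] [DiscreteTopology B] (ψ : ℤ_[p] → B)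
    (hψ : Continuous ψ) :
    ∃ m : ℕ, ∀ z z' : ℤ_[p], PadicInt.toZModPow m z = PadicInt.toZModPow m z' → ψ z = ψ z' := by
  -- around each `t`, `ψ` is constant on a congruence class mod `p^{m_t}`
  have hloc : ∀ t : ℤ_[p], ∃ m : ℕ, ∀ z, PadicInt.toZModPow m z = PadicInt.toZModPow m t →
      ψ z = ψ t := fun t => by
    have ho : IsOpen (ψ ⁻¹' {ψ t}) := (isOpen_discrete _).preimage hψ
    obtain ⟨ε, hε, hball⟩ := Metric.isOpen_iff.1 ho t rfl
    obtain ⟨m, hm⟩ := PadicInt.exists_pow_neg_lt p hε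
    refine ⟨m, fun z hz => ?_⟩
    have hle : ‖z - t‖ ≤ (p : ℝ) ^ (-(m : ℤ)) := by
      rw [PadicInt.norm_le_pow_iff_mem_span_pow, ← PadicInt.ker_toZModPow, RingHom.mem_ker, map_sub,
        hz, sub_self]
    have hzb : z ∈ Metric.ball t ε := by
      rw [Metric.mem_ball, dist_eq_norm]; exact lt_of_le_of_lt hle hm
    exact hball hzb
  choose m hm using hloc
  -- a finite subcover of the cover by the classes `V_t`
  let V : ℤ_[p] → Set ℤ_[p] := fun t => {z | PadicInt.toZModPow (m t) z = PadicInt.toZModPow (m t) t}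
  have hVo : ∀ t, IsOpen (V t) := fun t =>
    Literature.NumberTheory.GaloisRepresentations.OneUnits.isOpen_setOf_toZModPow_eq p (m t) _
  obtain ⟨T, hT⟩ := isCompact_univ.elim_finite_subcover V hVo fun t _ => Set.mem_iUnion.2 ⟨t, rfl⟩
  refine ⟨T.sup m, fun z z' hzz' => ?_⟩
  obtain ⟨i, hi, hzi⟩ : ∃ i ∈ T, z ∈ V i := by
    simpa only [Set.mem_iUnion, exists_prop] using hT (Set.mem_univ z)
  have hmi : m i ≤ T.sup m := Finset.le_sup hi
  have hz'i : PadicInt.toZModPow (m i) z' = PadicInt.toZModPow (m i) i := by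
    rw [← hzi, ← PadicInt.cast_toZModPow (m i) (T.sup m) hmi z',
      ← PadicInt.cast_toZModPow (m i) (T.sup m) hmi z, hzz']
  rw [hm i z hzi, hm i z' hz'i]

/-- A `p^m`-periodic sum over `p^m · k` consecutive naturals is `k` times the sum over one period.
[folklore] -/
theorem sum_range_mul_eq_smul_sum {B : Type*} [AddCommMonoid B] (ψ : ℤ_[p] → B) (m : ℕ)
    (hψ : ∀ z z' : ℤ_[p], PadicInt.toZModPow m z = PadicInt.toZModPow m z' → ψ z = ψ z') (k : ℕ) :
    ∑ i ∈ Finset.range (p ^ m * k), ψ (i : ℕ) = k • ∑ i ∈ Finset.range (p ^ m), ψ (i : ℕ) := by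
  induction k with
  | zero => simp
  | succ k ih =>
    rw [mul_add, mul_one, Finset.sum_range_add, ih, add_smul, one_smul]
    congr 1
    refine Finset.sum_congr rfl fun j _ => hψ _ _ ?_
    have e : ((p ^ m * k + j : ℕ) : ZMod (p ^ m)) = (j : ZMod (p ^ m)) := by
      rw [Nat.cast_add, Nat.cast_mul, ZMod.natCast_self, zero_mul, zero_add]
    rw [map_natCast, map_natCast, e]

end ZpQuotient

/-! ## 4. The short exact sequence `0 → A → M_G^H(A) →(S_γ − 1) M_G^H(A) → 0` for `H = ker κ`,
`κ : G ↠ ℤ_p`, `κ(γ) = 1`, `A` a `p`-primary discrete `G`-module -/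

section SES

variable {G : Type u} [Group G] [TopologicalSpace G] [IsTopologicalGroup G] [CompactSpace G]
variable {A : Type u} [AddCommGroup A] [DistribMulAction G A] [TopologicalSpace A]
  [DiscreteTopology A]
variable (hA : ∀ a : A, IsOpen {g : G | g • a = a})
variable {p : ℕ} [Fact p.Prime] (κ : G →ₜ* Multiplicative ℤ_[p])

/-- `H = ker κ ≤ G` (closed normal subgroup with `G/H ≅ ℤ_p` when `κ` is onto). [folklore] -/
abbrev kerK : Subgroup G := (κ : G →* Multiplicative ℤ_[p]).ker

omit [IsTopologicalGroup G] [CompactSpace G] in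
/-- `ker κ` is closed. [folklore] -/
theorem isClosed_kerK : IsClosed ((kerK κ : Subgroup G) : Set G) := by
  have : ((kerK κ : Subgroup G) : Set G) = κ ⁻¹' {1} := by
    ext g; simp [MonoidHom.mem_ker]
  rw [this]
  exact (isClosed_singleton.preimage κ.continuous)

/-- The function `φ_y(x) = x⁻¹ • y(x)` attached to `y ∈ M_G^H(A)`; it is constant on the cosets
`H x`. [folklore] -/
def phi (y : coindModule (subRep hA (kerK κ))) (x : G) : A := x⁻¹ • (y : C(G, A)) x

omit [CompactSpace G] in
/-- `φ_y` is continuous. [folklore] -/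
theorem continuous_phi (y : coindModule (subRep hA (kerK κ))) : Continuous (phi hA κ y) :=
  (continuous_smul' hA).comp (continuous_inv.prodMk (y : C(G, A)).continuous)

omit [CompactSpace G] in
/-- `φ_y(h x) = φ_y(x)` for `h ∈ H`. [folklore] -/
theorem phi_mul (y : coindModule (subRep hA (kerK κ))) (h : G) (hh : h ∈ kerK κ) (x : G) :
    phi hA κ y (h * x) = phi hA κ y x := by
  rw [phi, phi, show h * x = ((⟨h, hh⟩ : kerK κ) : G) * x from rfl, coind_apply_mul, smul_smul]
  simp [mul_assoc]

omit [CompactSpace G] in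
/-- `x • φ_y(x) = y(x)`. [folklore] -/
theorem smul_phi (y : coindModule (subRep hA (kerK κ))) (x : G) :
    x • phi hA κ y x = (y : C(G, A)) x := by
  rw [phi, smul_inv_smul]

variable (hκ : Surjective κ) {γ : G} (hγ : κ γ = Multiplicative.ofAdd 1)

omit [IsTopologicalGroup G] [CompactSpace G] in
include hγ in
/-- `toZp κ (γ x) = 1 + toZp κ x`. [folklore] -/
theorem toZp_gamma_mul (x : G) : toZp κ (γ * x) = 1 + toZp κ x := by
  rw [toZp_mul', toZp_apply, hγ]; rfl

include hκ hγ in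
/-- **Exactness in the middle**: if `S_γ y = y` then `y = unit (y 1)` — a continuous function on
`G/H ≅ ℤ_p` invariant under `t ↦ t + 1` is constant (density of `ℤ` in `ℤ_p`). [folklore] -/
theorem exists_unit_eq_of_tHom_eq_zero (y : coindModule (subRep hA (kerK κ)))
    (hy : (tHom hA (kerK κ) γ).hom y = 0) : ∃ a : A, unitFun hA (kerK κ) a = y := by
  have hy' : ∀ x, γ⁻¹ • (y : C(G, A)) (γ * x) = (y : C(G, A)) x := fun x => by
    have h0 : γ⁻¹ • (y : C(G, A)) (γ * x) - (y : C(G, A)) x = 0 :=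
      congrArg (fun f : coindModule (subRep hA (kerK κ)) => (f : C(G, A)) x) hy
    exact sub_eq_zero.1 h0
  -- `φ_y` descends to `ψ : ℤ_p → A`, continuous and `1`-periodic
  set ψ := descend κ hκ (phi hA κ y) with hψdef
  have hψc : Continuous ψ := continuous_descend κ hκ (continuous_phi hA κ y) (phi_mul hA κ y)
  have hψφ : ∀ x, ψ (toZp κ x) = phi hA κ y x := descend_toZp κ hκ (phi_mul hA κ y)
  have hγφ : ∀ x, phi hA κ y (γ * x) = phi hA κ y x := fun x => by
    rw [phi, phi, mul_inv_rev, ← smul_smul, hy']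
  have h1 : ∀ t, ψ (1 + t) = ψ t := fun t => by
    obtain ⟨x, rfl⟩ := toZp_surjective κ hκ t
    rw [← toZp_gamma_mul κ hγ, hψφ, hψφ, hγφ]
  have hnat : ∀ (k : ℕ) (t : ℤ_[p]), ψ (k + t) = ψ t := fun k t => by
    induction k with
    | zero => simp
    | succ k ih => rw [Nat.cast_succ, add_comm (k : ℤ_[p]) 1, add_assoc, h1, ih]
  have hint : ∀ k : ℤ, ψ (k : ℤ_[p]) = ψ 0 := fun k => by
    obtain ⟨n, rfl | rfl⟩ := Int.eq_nat_or_neg k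
    · simpa using hnat n 0
    · have := hnat n (-(n : ℤ_[p]))
      simp only [add_neg_cancel] at this
      rw [Int.cast_neg, Int.cast_natCast, ← this]
  -- density of `ℤ` in `ℤ_p`
  have hall : ∀ t, ψ t = ψ 0 := by
    have hcl : IsClosed {t : ℤ_[p] | ψ t = ψ 0} := isClosed_eq hψc continuous_const
    have hd : Dense {t : ℤ_[p] | ψ t = ψ 0} :=
      (PadicInt.denseRange_intCast (p := p)).mono (by rintro _ ⟨k, rfl⟩; exact hint k)
    have huniv : {t : ℤ_[p] | ψ t = ψ 0} = Set.univ := by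
      rw [← hcl.closure_eq, hd.closure_eq]
    exact fun t => (Set.eq_univ_iff_forall.1 huniv t)
  refine ⟨(y : C(G, A)) 1, Subtype.ext (ContinuousMap.ext fun x => ?_)⟩
  have hx : phi hA κ y x = phi hA κ y 1 := by
    rw [← hψφ, ← hψφ, hall (toZp κ x), hall (toZp κ 1)]
  rw [unitFun_apply, ← smul_phi hA κ y x, hx, phi, inv_one, one_smul]

include hκ hγ in
/-- **Surjectivity of `S_γ − 1`** on `M_G^H(A)` for `p`-PRIMARY `A`: the telescoping primitive
`Ψ(t) = Σ_{i < t mod p^N} ψ(i)` of the descended function `ψ = φ_b` is well defined on `ℤ/p^N`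
because `Σ_{i<p^N} ψ(i) = p^{N−m} Σ_{i<p^m} ψ(i) = 0` for `N ≫ m`.
[cite: JetchevSkinnerWan2017, Lemma 3.3.3 (arXiv:1512.06894 p. 11) ("`0 → W → M → M → 0`")] -/
theorem tHom_surjective (hAt : IsPrimaryTorsion p A) :
    Surjective ((tHom hA (kerK κ) γ).hom) := by
  intro b
  have hp : p.Prime := Fact.out
  -- descend `φ_b`
  set ψ := descend κ hκ (phi hA κ b) with hψdef
  have hψc : Continuous ψ := continuous_descend κ hκ (continuous_phi hA κ b) (phi_mul hA κ b)
  have hψφ : ∀ x, ψ (toZp κ x) = phi hA κ b x := descend_toZp κ hκ (phi_mul hA κ b)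
  obtain ⟨m, hm⟩ := exists_factor_toZModPow ψ hψc
  obtain ⟨e, he⟩ := hAt (∑ i ∈ Finset.range (p ^ m), ψ (i : ℕ))
  set N := m + (e + 1) with hNdef
  have hmN : m ≤ N := Nat.le_add_right _ _
  have hN0 : N ≠ 0 := by omega
  have hsum : ∑ i ∈ Finset.range (p ^ N), ψ (i : ℕ) = 0 := by
    rw [hNdef, pow_add, sum_range_mul_eq_smul_sum ψ m hm, pow_succ', mul_smul, he, smul_zero]
  haveI : NeZero (p ^ N) := ⟨pow_ne_zero _ hp.ne_zero⟩
  haveI : Fact (1 < p ^ N) := ⟨Nat.one_lt_pow hN0 hp.one_lt⟩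
  -- the primitive
  let Ψ : ℤ_[p] → A := fun t => ∑ i ∈ Finset.range (PadicInt.toZModPow N t).val, ψ (i : ℕ)
  have hΨc : Continuous Ψ :=
    (continuous_of_discreteTopology (f := fun r : ZMod (p ^ N) =>
      ∑ i ∈ Finset.range r.val, ψ (i : ℕ))).comp
      (Literature.NumberTheory.GaloisRepresentations.OneUnits.continuous_toZModPow p N)
  have hΨ : ∀ t, Ψ (t + 1) = Ψ t + ψ t := fun t => by
    set r := PadicInt.toZModPow N t with hr
    have hNr : PadicInt.toZModPow N ((r.val : ℕ) : ℤ_[p]) = PadicInt.toZModPow N t := by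
      rw [map_natCast, ZMod.natCast_zmod_val]
    have hψt : ψ t = ψ ((r.val : ℕ) : ℤ_[p]) := hm _ _ (by
      rw [← PadicInt.cast_toZModPow m N hmN t, ← PadicInt.cast_toZModPow m N hmN, hNr])
    change ∑ i ∈ Finset.range (PadicInt.toZModPow N (t + 1)).val, ψ (i : ℕ) =
      ∑ i ∈ Finset.range r.val, ψ (i : ℕ) + ψ t
    rw [map_add, map_one, ← hr]
    by_cases hc : r.val + 1 < p ^ N
    · have hval : (r + 1).val = r.val + 1 := by
        rw [ZMod.val_add_of_lt (by rwa [ZMod.val_one]), ZMod.val_one]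
      rw [hval, Finset.sum_range_succ, hψt]
    · have hv : r.val + 1 = p ^ N := by have := ZMod.val_lt r; omega
      have hval : (r + 1).val = 0 := by rw [ZMod.val_add, ZMod.val_one, hv, Nat.mod_self]
      rw [hval, Finset.sum_range_zero, hψt, ← Finset.sum_range_succ (fun i : ℕ => ψ (i : ℕ)) r.val,
        hv, hsum]
  -- the preimage `a(x) = x • Ψ(κ x)`
  have hmem : (⟨fun x => x • Ψ (toZp κ x), (continuous_smul' hA).comp
      (continuous_id.prodMk (hΨc.comp (continuous_toZp κ)))⟩ : C(G, A)) ∈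
      coindModule (subRep hA (kerK κ)) := fun h x => by
    change ((h : G) * x) • Ψ (toZp κ ((h : G) * x)) = (h : G) • (x • Ψ (toZp κ x))
    rw [toZp_mul', toZp_eq_zero_of_mem κ h.2, zero_add, mul_smul]
  refine ⟨⟨_, hmem⟩, Subtype.ext (ContinuousMap.ext fun x => ?_)⟩
  rw [tHom_apply_apply]
  change γ⁻¹ • ((γ * x) • Ψ (toZp κ (γ * x))) - x • Ψ (toZp κ x) = (b : C(G, A)) x
  rw [toZp_gamma_mul κ hγ, smul_smul, inv_mul_cancel_left, add_comm, hΨ, smul_add,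
    add_sub_cancel_left, hψφ, smul_phi]

include hκ hγ in
/-- **`0 → A →(unit) M_G^H(A) →(S_γ − 1) M_G^H(A) → 0` is a short exact sequence of discrete
`G`-modules** (`H = ker κ`, `κ : G ↠ ℤ_p`, `κ(γ) = 1`, `A` `p`-primary) — JSW17's
`0 → W → M →(γ − 1) M → 0` in the `K_∞`-free form `M = M_G^H(W)`.
[cite: JetchevSkinnerWan2017, Lemma 3.3.3 (arXiv:1512.06894 p. 11)] [cite: SerreGaloisCohomology1997, I §2.5] -/
theorem isSES_unit_tHom (hAt : IsPrimaryTorsion p A) :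
    IsSES (unitHom hA (kerK κ)) (tHom hA (kerK κ) γ) where
  comp_eq_zero := by
    ext a x
    change γ⁻¹ • ((γ * x) • a) - x • a = 0
    rw [smul_smul, inv_mul_cancel_left, sub_self]
  injective := fun a b h => by
    have h1 : (1 : G) • a = (1 : G) • b :=
      congrArg (fun f : coindModule (subRep hA (kerK κ)) => (f : C(G, A)) 1) h
    simpa using h1
  exact_mid := fun y hy => exists_unit_eq_of_tHom_eq_zero hA κ hκ hγ y hy
  surjective := tHom_surjective hA κ hκ hγ hAt

end SES

end Summit.BirchSwinnertonDyer.Rank1Residual.X11b.ProcyclicDescent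

end
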